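import Summits.QuantumAdvantage.QuantumAdvantage.Theorems.LivenessSeparationLawR

set_option linter.dupNamespace false

/-!
# Liveness separation, part W — the two chain ends are a cyclic adjacent pair

Lens 4 (minimal counterexample), node `CoSupportDial`, memo S-PRIME §11.
On the ring the cut positions `0` and `n` are neighbours.  Their walk residues are tied together at EVERY input:
`r_n ≡ 2 r_0 + n + 2c (mod 3)` (`endCuts_residue`).  With `E := c + 2n`:
* `E ≡ 0`: the two end cuts are BONDED — live together or dead together at every input (`endCuts_bonded`); then the
  two end registers can be MERGED into one (`ringWinU_mergeEnds`: XOR register `n` into register `0` and silence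
  register `n`; the win bit is unchanged everywhere, by the parity lemma of part S), and the chain loses a cut;
* `E ≢ 0`: the two end cuts form a VIRTUAL ADJACENT PAIR — one or two of them live at every input, two iff
  `r_0 ≡ E` (`endCuts_pair_liveCount`) — and they enter the adjacent-pair calculus of parts R and V (imported): together with
  one genuine adjacent pair the four-cut live count is even exactly when the pairs are aligned
  (`endPair_liveCount_even`, `ringWinU_xorSet_endPair`).
So the «pinned chain ends» branch of the residual portrait is the adjacent-pair branch read cyclically.
-/

namespace Summit.QuantumAdvantage.QuantumAdvantage.Theorems.LivenessSeparation

open Finset Summit.QuantumAdvantage.AdviceFreeQNC0 InnerDegreeDial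

variable {n : ℕ}

/-- **the end residues are tied:** `r_n ≡ 2 r_0 + n + 2 c (mod 3)` at every input -/
theorem endCuts_residue (c : ℕ) (u : Fin n → Bool) :
    (c + n + walkExp u n) % 3 = (2 * (c + walkExp u 0) + n + 2 * c) % 3 := by
  have h0 : walkExp u 0 = wt u := by
    unfold walkExp wtPrefix
    simp
  have hn : walkExp u n = 2 * wt u := by
    unfold walkExp
    rw [ConstBells.wtPrefix_self]
    ring
  rw [h0, hn]
  omega

/-- **bonded ends (`E = c + 2n ≡ 0`):** the end cuts are live together or dead together at every input -/
theorem endCuts_bonded (c : ℕ) (u : Fin n → Bool) (hE : (c + 2 * n) % 3 = 0) :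
    liveCut c u (Fin.last n) = liveCut c u 0 := by
  have h := endCuts_residue c u
  have h3 : (c + walkExp u 0) % 3 < 3 := Nat.mod_lt _ (by omega)
  unfold liveCut
  rw [Fin.val_last, Fin.val_zero, add_zero]
  by_cases h0 : (c + walkExp u 0) % 3 ≠ 0
  · rw [decide_eq_true h0, decide_eq_true_eq]
    omega
  · rw [decide_eq_false h0, decide_eq_false_iff_not]
    omega

/-- **virtual adjacent pair (`E ≢ 0`):** one or two of the end cuts are live at every input, two iff `r_0 ≡ E` -/
theorem endCuts_pair_liveCount (c : ℕ) (u : Fin n → Bool) (hE : (c + 2 * n) % 3 ≠ 0) :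
    (if liveCut c u 0 = true then 1 else 0) + (if liveCut c u (Fin.last n) = true then 1 else 0)
      = if (c + walkExp u 0) % 3 = (c + 2 * n) % 3 then 2 else 1 := by
  rw [liveInd_eq c u 0, liveInd_eq c u (Fin.last n), Fin.val_last, Fin.val_zero, add_zero, endCuts_residue c u]
  -- `r_n ≡ 2 (r_0 + E)`; the case analysis is done on the two residues (omega alone does not see the divisibility)
  have key : (2 * (c + walkExp u 0) + n + 2 * c) % 3 = (2 * ((c + walkExp u 0) % 3) + 2 * ((c + 2 * n) % 3)) % 3 := by
    have e1 : 2 * (c + walkExp u 0) + 2 * (c + 2 * n) = (2 * (c + walkExp u 0) + n + 2 * c) + 3 * n := by ring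
    have e2 : (2 * (c + walkExp u 0) + 2 * (c + 2 * n)) % 3 = (2 * ((c + walkExp u 0) % 3) + 2 * ((c + 2 * n) % 3)) % 3 := by
      omega
    rw [← e2, e1, Nat.add_mul_mod_self_left]
  have h3 : (c + walkExp u 0) % 3 < 3 := Nat.mod_lt _ (by omega)
  have hE3 : (c + 2 * n) % 3 < 3 := Nat.mod_lt _ (by omega)
  rw [key]
  clear key
  generalize (c + walkExp u 0) % 3 = r at h3 ⊢
  generalize (c + 2 * n) % 3 = E at hE hE3 ⊢
  interval_cases r <;> interval_cases E <;> simp_all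

/-- the two end cuts as a set -/
def chainEnds (n : ℕ) : Finset (Fin (n + 1)) := {0, Fin.last n}

/-- **MERGING BONDED ENDS:** when `E ≡ 0`, XOR-ing register `n` into the two end registers — register `0` becomes `y_0 ⊕ y_n`, register `n` is
silenced — does not change the win bit at any input: the chain has one cut fewer. -/
theorem ringWinU_mergeEnds (c : ℕ) (y : Fin (n + 1) → (Fin n → Bool) → Bool) (u : Fin n → Bool) (hn : 1 ≤ n)
    (hE : (c + 2 * n) % 3 = 0) : ringWinU c (xorSet y (chainEnds n) (y (Fin.last n))) u = ringWinU c y u := by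
  have hne : (0 : Fin (n + 1)) ≠ Fin.last n := fun h => by
    have := congrArg Fin.val h
    rw [Fin.val_zero, Fin.val_last] at this
    omega
  refine ringWinU_xorSet_of_even c y (chainEnds n) (y (Fin.last n)) u ?_
  unfold chainEnds
  rw [card_filter, sum_insert (by simpa using hne), sum_singleton, endCuts_bonded c u hE]
  split_ifs <;> decide

/-- the merged strategy: register `n` is silenced -/
theorem mergeEnds_last (y : Fin (n + 1) → (Fin n → Bool) → Bool) (u : Fin n → Bool) :
    xorSet y (chainEnds n) (y (Fin.last n)) (Fin.last n) u = false := by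
  rw [xorSet_of_mem y _ (by simp [chainEnds]) u, Bool.xor_self]

/-- the merged strategy: register `0` carries `y_0 ⊕ y_n` (`n ≥ 1`) -/
theorem mergeEnds_zero (y : Fin (n + 1) → (Fin n → Bool) → Bool) (u : Fin n → Bool) :
    xorSet y (chainEnds n) (y (Fin.last n)) 0 u = xor (y 0 u) (y (Fin.last n) u) :=
  xorSet_of_mem y _ (by simp [chainEnds]) u

/-- the merged strategy: every other register is unchanged -/
theorem mergeEnds_other (y : Fin (n + 1) → (Fin n → Bool) → Bool) (u : Fin n → Bool) {g : Fin (n + 1)} (h0 : g ≠ 0)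
    (hl : g ≠ Fin.last n) : xorSet y (chainEnds n) (y (Fin.last n)) g u = y g u :=
  xorSet_of_not_mem y _ (by simp [chainEnds, h0, hl]) u

/-- **a genuine adjacent pair `{a, a+1}` and the virtual end pair `{0, n}` (`E ≢ 0`) carry an even number of live cuts iff they are aligned**:
doubly live together (`r_a ≡ 1 + u_a` iff `r_0 ≡ E`) -/
theorem endPair_liveCount_even (c : ℕ) (u : Fin n → Bool) (hE : (c + 2 * n) % 3 ≠ 0) (a : Fin n)
    (halign : (c + a.val + walkExp u a.val + 2 * (if u a = true then 1 else 0)) % 3 = 1 ↔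
      (c + walkExp u 0) % 3 = (c + 2 * n) % 3) :
    ((if liveCut c u a.castSucc = true then 1 else 0) + (if liveCut c u a.succ = true then 1 else 0)
      + ((if liveCut c u 0 = true then 1 else 0) + (if liveCut c u (Fin.last n) = true then 1 else 0))) % 2 = 0 := by
  rw [pair_liveCount c u a, endCuts_pair_liveCount c u hE]
  by_cases ha : (c + a.val + walkExp u a.val + 2 * (if u a = true then 1 else 0)) % 3 = 1
  · rw [if_pos ha, if_pos (halign.1 ha)]
  · rw [if_neg ha, if_neg (fun hb => ha (halign.2 hb))]

/-- the four cuts: a genuine pair strictly inside the chain and the two ends -/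
def endPairCuts (a : Fin n) : Finset (Fin (n + 1)) := {a.castSucc, a.succ, 0, Fin.last n}

/-- **CANCELLATION FOR A GENUINE PAIR PLUS THE VIRTUAL END PAIR:** where they are aligned, XOR-ing a common function into the four registers keeps the
win bit (`1 ≤ a`, `a + 2 ≤ n`: the four cuts are distinct). -/
theorem ringWinU_xorSet_endPair (c : ℕ) (y : Fin (n + 1) → (Fin n → Bool) → Bool) (h : (Fin n → Bool) → Bool) (u : Fin n → Bool)
    (hE : (c + 2 * n) % 3 ≠ 0) (a : Fin n) (ha1 : 1 ≤ a.val) (ha2 : a.val + 2 ≤ n)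
    (halign : (c + a.val + walkExp u a.val + 2 * (if u a = true then 1 else 0)) % 3 = 1 ↔
      (c + walkExp u 0) % 3 = (c + 2 * n) % 3) :
    ringWinU c (xorSet y (endPairCuts a) h) u = ringWinU c y u := by
  have h1 : a.castSucc ≠ a.succ := fun h => by have := congrArg Fin.val h; simp [Fin.val_succ] at this
  have h2 : a.castSucc ≠ 0 := fun h => by have := congrArg Fin.val h; simp at this; omega
  have h3 : a.castSucc ≠ Fin.last n := fun h => by have := congrArg Fin.val h; simp at this; omega
  have h4 : a.succ ≠ 0 := fun h => by have := congrArg Fin.val h; simp [Fin.val_succ] at this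
  have h5 : a.succ ≠ Fin.last n := fun h => by have := congrArg Fin.val h; simp [Fin.val_succ] at this; omega
  have h6 : (0 : Fin (n + 1)) ≠ Fin.last n := fun h => by have := congrArg Fin.val h; simp at this; omega
  refine ringWinU_xorSet_of_even c y (endPairCuts a) h u ?_
  unfold endPairCuts
  rw [card_filter, sum_insert (by simp [h1, h2, h3]), sum_insert (by simp [h4, h5]), sum_insert (by simpa using h6), sum_singleton,
    ← add_assoc, add_assoc (if liveCut c u a.castSucc = true then 1 else 0)]
  have := endPair_liveCount_even c u hE a halign
  omega

end Summit.QuantumAdvantage.QuantumAdvantage.Theorems.LivenessSeparation
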